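import Summits.KontsevichZagierPeriods.KontsevichZagierPeriods.Theses.GenusOneIterated

/-!
# `KummerLogTwo` (stmt-KontsevichZagierPeriods-6778, route GenusOneIterated) — birth skeleton

Crux (rank 4, difficulty M): at the lemniscatic curve `y² = 4x³ − 4x`, every KZ representation `r` of
`∫∫_{−1<x₀<x₁<0} (x₁ − x₀)/(√(4x₀³−4x₀) √(4x₁³−4x₁)) dx₀ dx₁` (= `I(ωη) − I(ηω)`) is KZ-equivalent to
every representation `r'` of `∫₁² du/(2u)` (= `½ log 2`): a pure Kummer period reached WITHOUT
regularisation, by reflection in the third 2-torsion point.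

Line "birth" = the route header's own two-layer plan for this node
(`KummerLogTwo ⇐ ReflectionCoV → ExactFormNL`), typed over existing declarations only, with the
intermediate representation made explicit: the antisymmetric integrand
`B(x₀,x₁) = −((σ(x₁) − x₁)/√f(x₁)) · (1/√f(x₀))`, `σ(x) = 1 + 2/(x − 1)` (the abscissa of `P₁ − P`),
`f(x) = 4x³ − 4x`, on the CLOSED band `{−1 < x₀ < 0, x₀ ≤ x₁ ≤ 0}` (the shape KZ rule 3 wants).

* `stub_reflectionToBand` (REFLECTION, rules 1a/2/1b only): `[r] − [b] ∈ KZ.relations` for every band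
  representation `b` of `B` — cut the triangle along the fixed curve `x₁ = σ(x₀)` of the involution
  `Φ(x₀,x₁) = (σx₁, σx₀)` (`σ*ω = −ω`), fold one half onto the other (rule 2), add integrands (rule 1b)
  with the exact-form identity `(σ(x) − x)/y = d/dx[y/(2(1 − x))]`, trade the symmetric term for the
  reflected `B`-half (rule 2), glue (rule 1a), close the triangle up to the band (null set).
* `stub_bandRepExists` (ADMISSIBILITY of the intermediate datum): `B` on the band IS a KZ representation —
  `ℚ`-semialgebraic domain and integrand, absolutely integrable (inverse-square-root corners at
  `x₀ → −1`, `x₁ → 0`, `x₀ → 0⁻`).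
* `stub_bandNewtonLeibniz` (EXACT FORM + NEWTON–LEIBNIZ, rules 3/2): `[b] − [r'] ∈ KZ.relations` —
  Newton–Leibniz along `x₁ ∈ [x₀, 0]` with the ALGEBRAIC primitive `F(x₀,x₁) = −φ(x₁)/√f(x₀)`,
  `φ(t) = √(4t³ − 4t)/(2(1 − t))`, `φ(0) = 0` at the torsion corner, base integrand
  `φ(x₀)/√f(x₀) = 1/(2(1 − x₀))` on `(−1, 0)`; then the affine change of variables `u = 1 − x₀` onto `r'`.

Composition `KummerLogTwo_of : stub₁-sig → stub₂-sig → stub₃-sig → KummerLogTwo` is sorry-free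
(`[r] − [r'] = ([r] − [b]) + ([b] − [r'])` in the free abelian group `KZ.FormalRep`);
`kummerLogTwo_skeleton : KummerLogTwo` feeds the three stubs in.

Cheapest closure known to the registrar (NOT used here — registrar does not prove): the general-modulus twin
`KummerFamily` (support item stmt-KontsevichZagierPeriods-6780) is LANDED
(`Summit.KontsevichZagierPeriods.GenusOneIterated.KummerFamily.equivalent`, nine-move certificate over
`E : KZ.EllCurve`); at `E₀ = ⟨1, 0, −1, …⟩` one has `E₀.f x = 4x³ − 4x` (`ring`) and
`(e₁ − e₂, e₁ − e₃) = (1, 2)` (`norm_num`), so the crux, and each stub (`nl_move`/`cov_affine` for stub 3,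
moves R1–R7 of `equivalent` for stub 1, `isSemialgebraic_band`/`isSemialgebraicFunOn_B`/`integrableOn_B`
for stub 2), is a specialisation away.
Disproof used: none on file (no `Cruxes/KummerLogTwo/Disproof.lean`, no dead lines, `ledger negatives` empty
for this sector).
-/

set_option linter.dupNamespace false

namespace Summit.KontsevichZagierPeriods.KontsevichZagierPeriods.Cruxes.KummerLogTwo.Birth

open Summit.KontsevichZagierPeriods.KontsevichZagierPeriods.Theses.GenusOneIterated (KummerLogTwo)

/-- Stub 1 (REFLECTION — moves (1a), (2), (1b), (1b), (2), (1a) + a null modification): for every KZ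
representation `r` of `(x₁ − x₀)/(√f(x₀)√f(x₁))` on the open triangle `{−1 < x₀ < x₁ < 0}` and every
representation `b` of the antisymmetric integrand `B = −((σx₁ − x₁)/√f(x₁))·(1/√f(x₀))`,
`σ(x) = 1 + 2/(x − 1)`, on the closed band `{−1 < x₀ < 0, x₀ ≤ x₁ ≤ 0}`, `[r] − [b]` is a KZ relation.
The involution `Φ(x₀,x₁) = (σx₁, σx₀)` of the triangle (fixed curve `x₁ = σx₀`) and the exact-form identity
`(σ(x) − x)/√f(x) = d/dx[√f(x)/(2(1 − x))]` do the work; no value is ever computed. Why it might fail: the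
crux's own risk (i) — `changeOfVariablesRel`'s `HasFDerivWithinAt`/`InjOn` clauses on the half-triangle
for the coordinate-swapping involution. Size M. [cite: KontsevichZagier2001, §1.2 rules (1),(2)] -/
theorem stub_reflectionToBand :
    ∀ (r b : Literature.NumberTheory.Transcendental.KZ.IntegralRep 2),
      r.domain = {x | -1 < x 0 ∧ x 0 < x 1 ∧ x 1 < 0} →
      Set.EqOn r.integrand (fun x => (x 1 - x 0) /
        (Real.sqrt (4 * x 0 ^ 3 - 4 * x 0) * Real.sqrt (4 * x 1 ^ 3 - 4 * x 1))) r.domain →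
      b.domain = {x | -1 < x 0 ∧ x 0 < 0 ∧ x 0 ≤ x 1 ∧ x 1 ≤ 0} →
      Set.EqOn b.integrand (fun x => -((1 + 2 / (x 1 - 1) - x 1) / Real.sqrt (4 * x 1 ^ 3 - 4 * x 1)) *
        (1 / Real.sqrt (4 * x 0 ^ 3 - 4 * x 0))) b.domain →
      Literature.NumberTheory.Transcendental.KZ.of r - Literature.NumberTheory.Transcendental.KZ.of b ∈
        Literature.NumberTheory.Transcendental.KZ.relations := by
  sorry

/-- Stub 2 (ADMISSIBILITY of the intermediate datum): the antisymmetric integrand `B` on the closed band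
`{−1 < x₀ < 0, x₀ ≤ x₁ ≤ 0}` is a Kontsevich–Zagier integral representation — the band is
`ℚ`-semialgebraic, `B` is a `ℚ`-semialgebraic function on it, and `B` is absolutely integrable there
(inverse-square-root singularities at the torsion corners `x₀ → −1`, `x₁ → 0` and along `x₀ → 0⁻`).
Why it might fail: only if the corner `(0,0)` were not integrable (it is: `∫_{x₀}^0 dx₁/√|x₁| ~ √|x₀|`
cancels `1/√|x₀|`). Size S/M. [cite: KontsevichZagier2001, §1.1 Definition] -/
theorem stub_bandRepExists :
    ∃ b : Literature.NumberTheory.Transcendental.KZ.IntegralRep 2,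
      b.domain = {x | -1 < x 0 ∧ x 0 < 0 ∧ x 0 ≤ x 1 ∧ x 1 ≤ 0} ∧
      Set.EqOn b.integrand (fun x => -((1 + 2 / (x 1 - 1) - x 1) / Real.sqrt (4 * x 1 ^ 3 - 4 * x 1)) *
        (1 / Real.sqrt (4 * x 0 ^ 3 - 4 * x 0))) b.domain := by
  sorry

/-- Stub 3 (EXACT FORM + NEWTON–LEIBNIZ, then the affine move — rules (3), (2)): for every band
representation `b` of `B` and every representation `r'` of `1/(2u)` on `(1, 2)`, `[b] − [r']` is a KZ
relation: Newton–Leibniz along the last coordinate `x₁ ∈ [x₀, 0]` over the base `(−1, 0)` with the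
ALGEBRAIC (`ℚ`-semialgebraic) primitive `F(x₀,x₁) = −φ(x₁)/√f(x₀)`, `φ(t) = √(4t³ − 4t)/(2(1 − t))`,
continuous on the closed fibre, `∂F/∂x₁ = B` inside, `φ(0) = 0` at the torsion corner, base integrand
`φ(x₀)/√f(x₀) = 1/(2(1 − x₀))`; then `u = 1 − x₀` (Jacobian `−1`) maps `(−1, 0)` onto `(1, 2)` with
integrand `1/(2u)` — the logarithm stays unfolded as `∫ du/(2u)` (barrier `noSemialgebraicPrimitive_inv_sub_two`
not engaged). Why it might fail: the crux's own risk (ii) — `HasDerivAt` of `φ` on the open fibre and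
continuity of `F` up to `x₁ = 0` in the exact shape `newtonLeibnizRel` demands (`Fin.snoc`/`Fin.init` band).
Size M. [cite: KontsevichZagier2001, §1.2 rules (2),(3)] -/
theorem stub_bandNewtonLeibniz :
    ∀ (b : Literature.NumberTheory.Transcendental.KZ.IntegralRep 2)
      (r' : Literature.NumberTheory.Transcendental.KZ.IntegralRep 1),
      b.domain = {x | -1 < x 0 ∧ x 0 < 0 ∧ x 0 ≤ x 1 ∧ x 1 ≤ 0} →
      Set.EqOn b.integrand (fun x => -((1 + 2 / (x 1 - 1) - x 1) / Real.sqrt (4 * x 1 ^ 3 - 4 * x 1)) *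
        (1 / Real.sqrt (4 * x 0 ^ 3 - 4 * x 0))) b.domain →
      r'.domain = {x | 1 < x 0 ∧ x 0 < 2} →
      Set.EqOn r'.integrand (fun x => 1 / (2 * x 0)) r'.domain →
      Literature.NumberTheory.Transcendental.KZ.of b - Literature.NumberTheory.Transcendental.KZ.of r' ∈
        Literature.NumberTheory.Transcendental.KZ.relations := by
  sorry

open Literature.NumberTheory.Transcendental

/-- **Composition** (sorry-free): reflection to the band representation, then exact form + Newton–Leibniz +
affine move, chained in the free abelian group: `[r] − [r'] = ([r] − [b]) + ([b] − [r'])`. Concludes the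
route declaration `…Theses.GenusOneIterated.KummerLogTwo` by name. [cite: KontsevichZagier2001, §1.2] -/
theorem KummerLogTwo_of :
    (∀ (r b : KZ.IntegralRep 2),
      r.domain = {x | -1 < x 0 ∧ x 0 < x 1 ∧ x 1 < 0} →
      Set.EqOn r.integrand (fun x => (x 1 - x 0) /
        (Real.sqrt (4 * x 0 ^ 3 - 4 * x 0) * Real.sqrt (4 * x 1 ^ 3 - 4 * x 1))) r.domain →
      b.domain = {x | -1 < x 0 ∧ x 0 < 0 ∧ x 0 ≤ x 1 ∧ x 1 ≤ 0} →
      Set.EqOn b.integrand (fun x => -((1 + 2 / (x 1 - 1) - x 1) / Real.sqrt (4 * x 1 ^ 3 - 4 * x 1)) *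
        (1 / Real.sqrt (4 * x 0 ^ 3 - 4 * x 0))) b.domain →
      KZ.of r - KZ.of b ∈ KZ.relations) →
    (∃ b : KZ.IntegralRep 2,
      b.domain = {x | -1 < x 0 ∧ x 0 < 0 ∧ x 0 ≤ x 1 ∧ x 1 ≤ 0} ∧
      Set.EqOn b.integrand (fun x => -((1 + 2 / (x 1 - 1) - x 1) / Real.sqrt (4 * x 1 ^ 3 - 4 * x 1)) *
        (1 / Real.sqrt (4 * x 0 ^ 3 - 4 * x 0))) b.domain) →
    (∀ (b : KZ.IntegralRep 2) (r' : KZ.IntegralRep 1),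
      b.domain = {x | -1 < x 0 ∧ x 0 < 0 ∧ x 0 ≤ x 1 ∧ x 1 ≤ 0} →
      Set.EqOn b.integrand (fun x => -((1 + 2 / (x 1 - 1) - x 1) / Real.sqrt (4 * x 1 ^ 3 - 4 * x 1)) *
        (1 / Real.sqrt (4 * x 0 ^ 3 - 4 * x 0))) b.domain →
      r'.domain = {x | 1 < x 0 ∧ x 0 < 2} →
      Set.EqOn r'.integrand (fun x => 1 / (2 * x 0)) r'.domain →
      KZ.of b - KZ.of r' ∈ KZ.relations) →
    KummerLogTwo := by
  intro hRefl hBand hNL r r' hdom hint hdom' hint'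
  obtain ⟨b, hb, hbi⟩ := hBand
  have h₁ : KZ.of r - KZ.of b ∈ KZ.relations := hRefl r b hdom hint hb hbi
  have h₂ : KZ.of b - KZ.of r' ∈ KZ.relations := hNL b r' hb hbi hdom' hint'
  show KZ.of r - KZ.of r' ∈ KZ.relations
  have key : KZ.of r - KZ.of r' = (KZ.of r - KZ.of b) + (KZ.of b - KZ.of r') := by abel
  rw [key]
  exact add_mem h₁ h₂

/-- The by-name skeleton theorem: the three stubs fed into `KummerLogTwo_of` (its only `sorryAx`
dependencies are `stub_reflectionToBand`, `stub_bandRepExists`, `stub_bandNewtonLeibniz`).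
[cite: KontsevichZagier2001, §1.2] -/
theorem kummerLogTwo_skeleton : KummerLogTwo :=
  KummerLogTwo_of stub_reflectionToBand stub_bandRepExists stub_bandNewtonLeibniz

end Summit.KontsevichZagierPeriods.KontsevichZagierPeriods.Cruxes.KummerLogTwo.Birth
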